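import Literature.MathematicalPhysics.QuantumFieldTheory.Balaban1983to89.B8Thm2TorusBridge

/-!
# `Balaban1983to89.B8Thm2TorusPointwise` — [Balaban1985RegularSpaces] THEOREM 2 (p. 83) FOR `Ω_j = T_η`: the weighted-norm members of the torus
# bridge read POINTWISE AND STRICT «on Ω_j» as print states them — (1.36)₁,₂ `|A|, |∇^η_{U₀}A| < B₁(…)(Lʲη)^{−1,−2}` and (1.39)
# `|D^{η*}_{U₀}D^η_{U₀}A|, |Δ^η_{U₀}A| < B₁(…)(Lʲη)⁻³` (the interface's `C139T`) — module M4-fine of `lit-balaban-p33/T2S-MAP.md` (sub-row «G-B8-T2S»)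

statement-level skeleton of published theorems with citation tags; proofs where landed; nothing here is a claim about the
Yang–Mills mass gap

T. Bałaban, *Spaces of regular gauge field configurations on a lattice and gauge fixing conditions*, Commun. Math. Phys. **99** (1985) 75–102
`[Balaban1985RegularSpaces]`: Theorem 2 p. 83, (1.36)–(1.39) pp. 82–83 («on Ω_j»), p. 86 (the norms `|·|₍α₎ = sup_j sup_{Ω_j}(Lʲη)^{−α}|·|`),
(1.1)–(1.2) p. 76; [Balaban1985BackgroundPropagators] (3.4) p. 391, (3.23) p. 394.  STATUS: published, refereed.

CITATION HEADER (lean-in-tree rule).  Cell `lit-balaban`, seat `lit-balaban-p33` (gen 90), sub-row «G-B8-T2S» ([B8] §3 Theorem 2 torus supplier for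
R3 `stmt-QuantumFields-19200`), module M4-fine.  WHAT IS REPRODUCED: print states (1.36), (1.39) pointwise and strict «on Ω_j»; the knit delivers the
weighted suprema `|·|₍₋₂₎`, `|·|₍₋₃₎` (`B8ScaledSupNorm.msup`, a real `iSup`).  Reading a bound on the supremum back at a point needs the family to be
BOUNDED (`B8ScaledSupNorm.Bdd`, `weight_mul_norm_le_msup`); at `Ω_j = ℤᵈ` this follows from the (1.36)₁ bound `|A| ≤ c η⁻¹` on ALL bonds and the
locality of the stencils (`B8Eq155JBound.norm_covDerivFwd_le_of_141`, `B8Eq143PlaqExpansion.norm_covDeriv_le`, `plaqCovDeriv_eq_covDerivFwd`);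
strictness by enlarging the constant (`B₁ + 1`, the smallness parameter being positive).  Kind: theorems only; no `def`, no `… : Prop` fact.

## WHAT IS CERTIFIED HERE (kernel; axioms `propext` ∕ `Classical.choice` ∕ `Quot.sound`)
* §1 crude global bounds: `norm_pdiv_le_of_forall`, `norm_covLap_le_of_forall`; `le_of_weight_mul_le` (a weighted bound read pointwise);
* §2 **`thm2T_pointwise_of_socketsE`** — `B8Thm2TorusBridge.thm2T_core_of_socketsE` with (1.36)₁,₂ and (1.39)₁,₂ POINTWISE AND STRICT at every level
  `j ≤ k` and every bond ∕ site (the latter two = `B8Thm2TorusAt.C139T L k η B₁ s U₀ A`, `s = α₀ + (11d²α₀ + α₁)`), (1.37) `C137T`, (1.38)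
  `IsLandau138 … univ (torusLam k)`; ONE triple of constants; modulo the four knit sockets at torus members (as in M2).

## HONEST SCOPE — what is NOT claimed
(i) The Hölder member (1.36)₃ stays in the knit's weighted-norm currency at the family's fixed exponent `β` (`thm2T_core_of_socketsE`); a pointwise
reading needs a lower bound on the admissible lengths `len` and is not attempted here.  (ii) Smallness letter `α₀ + (11d²α₀ + α₁)` (the knit's), not
`α₀ + α₁`.  (iii) Sockets, periodicity (M1c `B8Thm2TorusPeriodic`) and `SU(N)`-closure as in the map.  (iv) `d ≥ 2`, `L ≥ 2`, `𝔸` a C⋆-algebra.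
Count-neutral; N05 not discharged; nothing continuum ∕ ℝ⁴ ∕ OS ∕ mass-gap ∕ Clay.
-/

noncomputable section

open NormedSpace
open scoped BigOperators

namespace Literature.MathematicalPhysics.QuantumFieldTheory.Balaban1983to89.B8Thm2TorusPointwise

open B7Prop1Explicit (e U1)
open B7Prop2Explicit (unitaryUnits unitaryUnits_le_U1)
open B7Eq92Concrete (mgauge)
open B8Ineq132 (InAk BondTouches covDerivFwd covDeriv)
open B8Eq119TwistedAxial (Restr129 InAx)
open B8Eq140Level (SideTouches)
open B8Eq184Proof (cfgExp)
open B8Eq146AExpansion (plaqCovDeriv plaqCovDeriv_eq_covDerivFwd)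
open B8Eq143PlaqExpansion (pdiv norm_covDeriv_le)
open B8Eq138LandauZd (IsLandau138 covLap covDivB)
open B8Eq155JBound (norm_covDerivFwd_le_of_141)
open B8ScaledSupNorm (msup bondNorm weight Bdd bdd_of_forall weight_mul_norm_le_msup weight_neg_natCast scale_pos)
open B8Thm4TorusAt (torusLam)
open B8Thm2TorusAt (Cond135T C137T C139T)
open B8LeafModelZdSockP5uE (SockP5uE)
open B8LeafModelZdOfHFP (SockHFP₀ SockHFP)
open B8LeafModelZd3 (SockB9P3)
open B8Thm2TorusMember (TorusMember torusIdx)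
open B8Thm2TorusBridge (thm2T_core_of_socketsE)

-- the `ℤ^d` sites of `B7Prop1Explicit` are `LSite` here (convention of `B8Thm2TorusAt`).
open B7Prop1Explicit renaming Site → LSite

variable {d : ℕ}

/-! ## §1  Crude global bounds and the pointwise reading of a weighted bound -/

section Crude

variable {𝔸 : Type*} [NormedRing 𝔸] [NormOneClass 𝔸] [NormedAlgebra ℂ 𝔸]

/-- **Crude bound of the divergence of a bounded plaquette field**: `|(D^{η*}_V F)_μ(x)| ≤ 2d·η⁻¹·2f` if `|F| ≤ f` everywhere (`U1`-valued `V`).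
[cite: Balaban1985RegularSpaces, (1.2) p.76, (1.39) p.83] -/
theorem norm_pdiv_le_of_forall {η : ℝ} (hη : 0 < η) {V : LSite d → Fin d → 𝔸ˣ} (hV : ∀ y κ, V y κ ∈ U1 𝔸)
    {F : Fin d → Fin d → LSite d → 𝔸} {f : ℝ} (hF : ∀ ν κ y, ‖F ν κ y‖ ≤ f) (μ : Fin d) (x : LSite d) :
    ‖pdiv η V F μ x‖ ≤ 2 * d * (η⁻¹ * (f + f)) := by
  unfold pdiv
  have hterm : ∀ (ν : Fin d) (G : LSite d → 𝔸), (∀ y, ‖G y‖ ≤ f) → ‖covDeriv η V ν G x‖ ≤ η⁻¹ * (f + f) := by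
    intro ν G hG
    exact (norm_covDeriv_le hη (hV _ _) G).trans (mul_le_mul_of_nonneg_left (add_le_add (hG _) (hG _)) (inv_nonneg.2 hη.le))
  have h1 : ‖∑ ν ∈ Finset.Iio μ, covDeriv η V ν (F ν μ) x‖ ≤ d * (η⁻¹ * (f + f)) := by
    refine (norm_sum_le _ _).trans ?_
    have h := Finset.sum_le_card_nsmul (Finset.Iio μ) (fun ν => ‖covDeriv η V ν (F ν μ) x‖) (η⁻¹ * (f + f))
      (fun ν _ => hterm ν (F ν μ) (hF ν μ))
    refine h.trans ?_
    rw [nsmul_eq_mul]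
    have hc : ((Finset.Iio μ).card : ℝ) ≤ d := by exact_mod_cast (Finset.card_le_univ _).trans (by simp)
    have h0 : 0 ≤ η⁻¹ * (f + f) := by
      have hf : 0 ≤ f := (norm_nonneg _).trans (hF μ μ x)
      positivity
    exact mul_le_mul_of_nonneg_right hc h0
  have h2 : ‖∑ ν ∈ Finset.Ioi μ, covDeriv η V ν (F μ ν) x‖ ≤ d * (η⁻¹ * (f + f)) := by
    refine (norm_sum_le _ _).trans ?_
    have h := Finset.sum_le_card_nsmul (Finset.Ioi μ) (fun ν => ‖covDeriv η V ν (F μ ν) x‖) (η⁻¹ * (f + f))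
      (fun ν _ => hterm ν (F μ ν) (hF μ ν))
    refine h.trans ?_
    rw [nsmul_eq_mul]
    have hc : ((Finset.Ioi μ).card : ℝ) ≤ d := by exact_mod_cast (Finset.card_le_univ _).trans (by simp)
    have h0 : 0 ≤ η⁻¹ * (f + f) := by
      have hf : 0 ≤ f := (norm_nonneg _).trans (hF μ μ x)
      positivity
    exact mul_le_mul_of_nonneg_right hc h0
  calc ‖∑ ν ∈ Finset.Iio μ, covDeriv η V ν (F ν μ) x - ∑ ν ∈ Finset.Ioi μ, covDeriv η V ν (F μ ν) x‖
      ≤ ‖∑ ν ∈ Finset.Iio μ, covDeriv η V ν (F ν μ) x‖ + ‖∑ ν ∈ Finset.Ioi μ, covDeriv η V ν (F μ ν) x‖ := norm_sub_le _ _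
    _ ≤ d * (η⁻¹ * (f + f)) + d * (η⁻¹ * (f + f)) := add_le_add h1 h2
    _ = 2 * d * (η⁻¹ * (f + f)) := by ring

/-- **Crude bound of the covariant Laplacian of a bounded function**: `|(Δ^η_V g)(x)| ≤ d·η⁻¹·2·(η⁻¹·2a)` if `|g| ≤ a` everywhere.
[cite: Balaban1985BackgroundPropagators, (3.23) p.394; Balaban1985RegularSpaces, (1.1)–(1.2) p.76] -/
theorem norm_covLap_le_of_forall {η : ℝ} (hη : 0 < η) {V : LSite d → Fin d → 𝔸ˣ} (hV : ∀ y κ, V y κ ∈ U1 𝔸)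
    {g : LSite d → 𝔸} {a : ℝ} (hg : ∀ y, ‖g y‖ ≤ a) (x : LSite d) :
    ‖covLap η V g x‖ ≤ d * (η⁻¹ * (η⁻¹ * (2 * a) + η⁻¹ * (2 * a))) := by
  unfold covLap covDivB
  have hD : ∀ (μ : Fin d) (y : LSite d), ‖covDerivFwd η V μ g y‖ ≤ η⁻¹ * (2 * a) := by
    intro μ y
    have h := norm_covDerivFwd_le_of_141 (A := fun z (_ : Fin d) => g z) hη hV (fun y _ => hg y) y μ μ
    exact h
  refine (norm_sum_le _ _).trans ?_
  have h := Finset.sum_le_card_nsmul (Finset.univ : Finset (Fin d))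
    (fun μ => ‖covDeriv η V μ (fun z => covDerivFwd η V μ g z) x‖) (η⁻¹ * (η⁻¹ * (2 * a) + η⁻¹ * (2 * a)))
    (fun μ _ => (norm_covDeriv_le hη (hV _ _) _).trans (mul_le_mul_of_nonneg_left (add_le_add (hD μ _) (hD μ _)) (inv_nonneg.2 hη.le)))
  refine h.trans (le_of_eq ?_)
  rw [nsmul_eq_mul, Finset.card_univ, Fintype.card_fin]

end Crude

section Weighted

variable {ι : Type*} {E : Type*} [SeminormedAddCommGroup E]

/-- **A bound on the weighted supremum `|F|₍₋ₙ₎ ≤ c` reads `‖F i‖ ≤ c·(Lʲη)⁻ⁿ` at every `i ∈ Ω_j`, `j ≤ k`**, for a BOUNDED weighted family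
(p. 86 «|A|₍α₎ = sup_j sup_{Ω_j}(Lʲη)^{−α}|A|» read backwards). [cite: Balaban1985RegularSpaces, p.86 (definition after (1.55)), (1.36)–(1.39) pp.82–83 («on Ω_j»)] -/
theorem le_of_weight_mul_le {L k : ℕ} (hL : 1 ≤ L) {η : ℝ} (hη : 0 < η) (n : ℕ) {mem : ℕ → ι → Prop} {F : ι → E}
    (hB : Bdd L k η (-(n : ℝ)) mem F) {c : ℝ} (hc : msup L k η (-(n : ℝ)) mem F ≤ c) {j : ℕ} (hj : j ≤ k) {i : ι} (hi : mem j i) :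
    ‖F i‖ ≤ c * (((L : ℝ) ^ j * η)⁻¹) ^ n := by
  have h1 : weight L η (-(n : ℝ)) j * ‖F i‖ ≤ c := (weight_mul_norm_le_msup hB hj hi).trans hc
  rw [weight_neg_natCast] at h1
  have hs : 0 < (L : ℝ) ^ j * η := scale_pos hL hη j
  have hsn : 0 < ((L : ℝ) ^ j * η) ^ n := pow_pos hs n
  rw [inv_pow, ← div_eq_mul_inv, le_div_iff₀ hsn, mul_comm]
  exact h1

end Weighted

/-! ## §2  Theorem 2 at the torus members with the (1.36)₁,₂ ∕ (1.39) members pointwise and strict -/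

section Pointwise

variable {𝔸 : Type} [CStarAlgebra 𝔸] [Nontrivial 𝔸]

omit [CStarAlgebra 𝔸] [Nontrivial 𝔸] in
/-- At `Ω = ℤᵈ` every bond is a side of a plaquette touching `Ω` (`d ≥ 2`). [cite: Balaban1985RegularSpaces, p.77 (plaquette ∕ bond conventions)] -/
private theorem sideTouches_univ₃ (hd2 : 2 ≤ d) (y : LSite d) (τ : Fin d) : SideTouches (Set.univ : Set (LSite d)) y τ := by
  haveI : Nontrivial (Fin d) := Fin.nontrivial_iff_two_le.mpr hd2
  obtain ⟨κ, hκ⟩ := exists_ne τ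
  exact B8Eq140Level.sideTouches_of_bondTouches hκ (Or.inl (Set.mem_univ y))

/-- **THEOREM 2 (p. 83) FOR `Ω_j = T_η`, POINTWISE STRICT MEMBERS** (see the module docstring): the core bridge `thm2T_core_of_socketsE` with (1.36)₁
`‖A_b‖ < B₁s(Lʲη)⁻¹`, (1.36)₂ `‖(D^η_{U₀,μ}A_κ)(x)‖ < B₁s(Lʲη)⁻²`, and (1.39) = `C139T L k η B₁ s U₀ A` at EVERY level `j ≤ k` and every bond ∕ site,
`s = α₀ + (11d²α₀ + α₁)`; (1.37) `C137T`, (1.38) `IsLandau138 … univ (torusLam k)`; ONE triple `B₁ B₂ c₁`; modulo the four knit sockets at torus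
members. [cite: Balaban1985RegularSpaces, Thm 2 p.83, (1.36)–(1.39) pp.82–83 («on Ω_j, j = 0, 1, …, k»), p.86, p.77 («Ω_j = T_η»)] -/
theorem thm2T_pointwise_of_socketsE (hd2 : 2 ≤ d) {L : ℕ} (hL : 2 ≤ L) {β : ℝ} {len : LSite d → ℝ}
    {B₀ B₀' B₀β cu cF₀ cF cu' cB9 : ℝ} (hB₀ : 0 < B₀) (hB₀' : 0 < B₀') (hB₀β : 0 < B₀β) (hB : 2 ≤ 5 * (d : ℝ) * L * B₀)
    (hcu : 0 < cu) (hcF₀ : 0 < cF₀) (hcF : 0 < cF) (hcu' : 0 < cu') (hcB9 : 0 < cB9)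
    (SHFP₀ : ∀ t : TorusMember, SockHFP₀ (𝔸 := 𝔸) L B₀ B₀' cF₀ (torusIdx (d := d) (le_trans one_le_two hL) t).η
      (torusIdx (d := d) (le_trans one_le_two hL) t).k (torusIdx (d := d) (le_trans one_le_two hL) t).Ω
      (torusIdx (d := d) (le_trans one_le_two hL) t).Λs)
    (SHFP : ∀ t : TorusMember, SockHFP (𝔸 := 𝔸) L B₀ B₀' cF (torusIdx (d := d) (le_trans one_le_two hL) t).η
      (torusIdx (d := d) (le_trans one_le_two hL) t).k (torusIdx (d := d) (le_trans one_le_two hL) t).Ω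
      (torusIdx (d := d) (le_trans one_le_two hL) t).Λs)
    (SP5u : ∀ t : TorusMember, SockP5uE (𝔸 := 𝔸) L B₀ cu' cu (torusIdx (d := d) (le_trans one_le_two hL) t).η
      (torusIdx (d := d) (le_trans one_le_two hL) t).k (torusIdx (d := d) (le_trans one_le_two hL) t).Ω
      (torusIdx (d := d) (le_trans one_le_two hL) t).Λs)
    (SB9all : ∀ t : TorusMember, ∀ m, m ≤ (torusIdx (d := d) (le_trans one_le_two hL) t).k →
      SockB9P3 (𝔸 := 𝔸) L B₀ B₀β cB9 β len (torusIdx (d := d) (le_trans one_le_two hL) t).η m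
        (torusIdx (d := d) (le_trans one_le_two hL) t).Ω (torusIdx (d := d) (le_trans one_le_two hL) t).Λs
        (torusIdx (d := d) (le_trans one_le_two hL) t).Λb) :
    ∃ B₁ B₂ c₁ : ℝ, 0 < B₁ ∧ 0 < B₂ ∧ 0 < c₁ ∧
      ∀ t : TorusMember, ∀ α₀ α₁ : ℝ, 0 < α₀ → 0 < α₁ → α₀ + α₁ ≤ c₁ →
        ∀ U₀ U' : LSite d → Fin d → 𝔸ˣ, (∀ x κ, U₀ x κ ∈ unitaryUnits 𝔸) → (∀ x κ, U' x κ ∈ unitaryUnits 𝔸) →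
          InAk L t.k t.η α₀ (fun _ => Set.univ) U₀ →
          InAk L t.k t.η α₀ (fun _ => Set.univ) (U' * U₀) → InAx L t.k (torusLam t.k) U₀ (U' * U₀) →
          Cond135T L t.k U₀ U' α₁ →
          ∃ u : LSite d → 𝔸ˣ, (∀ x, u x ∈ unitaryUnits 𝔸) ∧ Restr129 L t.k (torusLam t.k) U₀ u ∧
            ∃ A : LSite d → Fin d → 𝔸,
              (∀ (x : LSite d) (μ : Fin d), IsSelfAdjoint (A x μ)) ∧
              mgauge U₀ u⁻¹ U' = cfgExp t.η A ∧
              (∀ j, j ≤ t.k → ∀ (x : LSite d) (μ : Fin d),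
                ‖A x μ‖ < B₁ * (α₀ + (11 * (d : ℝ) ^ 2 * α₀ + α₁)) * ((L : ℝ) ^ j * t.η)⁻¹) ∧
              (∀ j, j ≤ t.k → ∀ (x : LSite d) (μ κ : Fin d),
                ‖covDerivFwd t.η U₀ μ (fun z => A z κ) x‖ < B₁ * (α₀ + (11 * (d : ℝ) ^ 2 * α₀ + α₁)) * (((L : ℝ) ^ j * t.η)⁻¹) ^ 2) ∧
              C137T L t.k t.η α₁ U₀ A ∧
              IsLandau138 L t.k t.η (Set.univ : Set (LSite d)) (torusLam t.k) U₀ A ∧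
              C139T L t.k t.η B₁ (α₀ + (11 * (d : ℝ) ^ 2 * α₀ + α₁)) U₀ A := by
  have hL1 : 1 ≤ L := le_trans one_le_two hL
  obtain ⟨B₁, B₂, c₁, hB₁, hB₂, hc₁, H⟩ :=
    thm2T_core_of_socketsE (𝔸 := 𝔸) (β := β) (len := len) hd2 hL hB₀ hB₀' hB₀β hB hcu hcF₀ hcF hcu' hcB9 SHFP₀ SHFP SP5u SB9all
  refine ⟨B₁ + 1, B₂, c₁, by linarith, hB₂, hc₁, ?_⟩
  intro t α₀ α₁ hα₀ hα₁ hs U₀ U' hU₀ hU' h33 h34 hAx h35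
  obtain ⟨u, hu, hR, A, hAsa, hWA, hA1, h137, hLan, hgrad, -, hJ, hLap⟩ :=
    H t α₀ α₁ hα₀ hα₁ hs U₀ U' hU₀ hU' h33 h34 hAx h35
  set s : ℝ := α₀ + (11 * (d : ℝ) ^ 2 * α₀ + α₁) with hs_def
  have hs0 : 0 < s := by rw [hs_def]; positivity
  have hη := t.hη
  have hU₀1 : ∀ y κ, U₀ y κ ∈ U1 𝔸 := fun y κ => unitaryUnits_le_U1 (hU₀ y κ)
  -- the global bound `|A| ≤ B₁ s η⁻¹` (level 0)
  have hA0 : ∀ (y : LSite d) (κ : Fin d), ‖A y κ‖ ≤ B₁ * s * t.η⁻¹ := by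
    intro y κ
    have h := hA1 0 (Nat.zero_le _) y κ
    simpa using h
  have hB₁s : 0 ≤ B₁ * s := by positivity
  -- strict enlargement at a scale
  have hlt : ∀ (n : ℕ) (j : ℕ), B₁ * s * (((L : ℝ) ^ j * t.η)⁻¹) ^ n < (B₁ + 1) * s * (((L : ℝ) ^ j * t.η)⁻¹) ^ n := by
    intro n j
    have hp : 0 < (((L : ℝ) ^ j * t.η)⁻¹) ^ n := pow_pos (inv_pos.2 (scale_pos hL1 hη j)) n
    have : B₁ * s < (B₁ + 1) * s := by nlinarith
    exact mul_lt_mul_of_pos_right this hp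
  refine ⟨u, hu, hR, A, hAsa, hWA, ?_, ?_, h137, hLan, ?_, ?_⟩
  · -- (1.36)₁ strict
    intro j hj x μ
    have h := hA1 j hj x μ
    have h1 := hlt 1 j
    simp only [pow_one] at h1
    exact h.trans_lt h1
  · -- (1.36)₂ pointwise strict, from the weighted norm (bounded family)
    intro j hj x μ κ
    have hbdd : Bdd L t.k t.η (-((2 : ℕ) : ℝ)) (fun _ (q : Fin d × Fin d × LSite d) => SideTouches (Set.univ : Set (LSite d)) q.2.2 q.2.1)
        (fun q => covDerivFwd t.η U₀ q.1 (fun z => A z q.2.1) q.2.2) := by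
      refine bdd_of_forall (c := ((L : ℝ) ^ t.k * t.η) ^ 2 * (t.η⁻¹ * (2 * (B₁ * s * t.η⁻¹)))) fun j' hj' q _ => ?_
      rw [weight_neg_natCast]
      have hq := norm_covDerivFwd_le_of_141 hη hU₀1 hA0 q.2.2 q.1 q.2.1
      have hsc : ((L : ℝ) ^ j' * t.η) ^ 2 ≤ ((L : ℝ) ^ t.k * t.η) ^ 2 := by
        have hLr : (1 : ℝ) ≤ L := by exact_mod_cast hL1
        have h1 : (L : ℝ) ^ j' * t.η ≤ (L : ℝ) ^ t.k * t.η :=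
          mul_le_mul_of_nonneg_right (pow_le_pow_right₀ hLr hj') hη.le
        exact pow_le_pow_left₀ (scale_pos hL1 hη j').le h1 2
      have h0 : 0 ≤ t.η⁻¹ * (2 * (B₁ * s * t.η⁻¹)) := by positivity
      exact (mul_le_mul (hsc) hq (norm_nonneg _) (by positivity)).trans le_rfl
    have hgrad' : msup L t.k t.η (-((2 : ℕ) : ℝ)) (fun _ (q : Fin d × Fin d × LSite d) => SideTouches (Set.univ : Set (LSite d)) q.2.2 q.2.1)
        (fun q => covDerivFwd t.η U₀ q.1 (fun z => A z q.2.1) q.2.2) ≤ B₁ * s := by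
      have e : (-((2 : ℕ) : ℝ)) = -(2 : ℝ) := by norm_num
      rw [e]; exact hgrad
    have h := le_of_weight_mul_le (F := fun q : Fin d × Fin d × LSite d => covDerivFwd t.η U₀ q.1 (fun z => A z q.2.1) q.2.2)
      hL1 hη 2 hbdd hgrad' hj (i := (μ, κ, x)) (sideTouches_univ₃ hd2 x κ)
    exact h.trans_lt (hlt 2 j)
  · -- (1.39)₁
    intro j hj x μ
    have hG : ∀ (y : LSite d) (κ τ : Fin d), ‖covDerivFwd t.η U₀ κ (fun z => A z τ) y‖ ≤ t.η⁻¹ * (2 * (B₁ * s * t.η⁻¹)) :=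
      fun y κ τ => norm_covDerivFwd_le_of_141 hη hU₀1 hA0 y κ τ
    have hP : ∀ (ν κ : Fin d) (y : LSite d), ‖plaqCovDeriv t.η U₀ A ν κ y‖ ≤ 2 * (t.η⁻¹ * (2 * (B₁ * s * t.η⁻¹))) :=
      fun ν κ y => B8Ineq1141SectG.norm_plaqCovDeriv_le U₀ hG ν κ y
    have hbdd : Bdd L t.k t.η (-((3 : ℕ) : ℝ)) (fun _ (b : LSite d × Fin d) => BondTouches (Set.univ : Set (LSite d)) b.1 b.2)
        (fun b => pdiv t.η U₀ (plaqCovDeriv t.η U₀ A) b.2 b.1) := by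
      refine bdd_of_forall (c := ((L : ℝ) ^ t.k * t.η) ^ 3 * (2 * d * (t.η⁻¹ * (2 * (t.η⁻¹ * (2 * (B₁ * s * t.η⁻¹))) +
          2 * (t.η⁻¹ * (2 * (B₁ * s * t.η⁻¹))))))) fun j' hj' b _ => ?_
      rw [weight_neg_natCast]
      have hq := norm_pdiv_le_of_forall hη hU₀1 hP b.2 b.1
      have hsc : ((L : ℝ) ^ j' * t.η) ^ 3 ≤ ((L : ℝ) ^ t.k * t.η) ^ 3 := by
        have hLr : (1 : ℝ) ≤ L := by exact_mod_cast hL1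
        have h1 : (L : ℝ) ^ j' * t.η ≤ (L : ℝ) ^ t.k * t.η :=
          mul_le_mul_of_nonneg_right (pow_le_pow_right₀ hLr hj') hη.le
        exact pow_le_pow_left₀ (scale_pos hL1 hη j').le h1 3
      exact mul_le_mul hsc hq (norm_nonneg _) (by positivity)
    have hJ' : bondNorm L t.k t.η (-((3 : ℕ) : ℝ)) (fun _ => (Set.univ : Set (LSite d)))
        (fun x μ => pdiv t.η U₀ (plaqCovDeriv t.η U₀ A) μ x) ≤ B₁ * s := by
      have e : (-((3 : ℕ) : ℝ)) = -(3 : ℝ) := by norm_num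
      rw [e]; exact hJ
    have h := le_of_weight_mul_le (F := fun b : LSite d × Fin d => pdiv t.η U₀ (plaqCovDeriv t.η U₀ A) b.2 b.1)
      hL1 hη 3 hbdd hJ' hj (i := (x, μ)) (Or.inl (Set.mem_univ x))
    exact h.trans_lt (hlt 3 j)
  · -- (1.39)₂
    intro j hj x κ
    have hbdd : Bdd L t.k t.η (-((3 : ℕ) : ℝ)) (fun _ (b : LSite d × Fin d) => BondTouches (Set.univ : Set (LSite d)) b.1 b.2)
        (fun b => covLap t.η U₀ (fun z => A z b.2) b.1) := by
      refine bdd_of_forall (c := ((L : ℝ) ^ t.k * t.η) ^ 3 *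
          (d * (t.η⁻¹ * (t.η⁻¹ * (2 * (B₁ * s * t.η⁻¹)) + t.η⁻¹ * (2 * (B₁ * s * t.η⁻¹)))))) fun j' hj' b _ => ?_
      rw [weight_neg_natCast]
      have hq := norm_covLap_le_of_forall hη hU₀1 (g := fun z => A z b.2) (fun y => hA0 y b.2) b.1
      have hsc : ((L : ℝ) ^ j' * t.η) ^ 3 ≤ ((L : ℝ) ^ t.k * t.η) ^ 3 := by
        have hLr : (1 : ℝ) ≤ L := by exact_mod_cast hL1
        have h1 : (L : ℝ) ^ j' * t.η ≤ (L : ℝ) ^ t.k * t.η :=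
          mul_le_mul_of_nonneg_right (pow_le_pow_right₀ hLr hj') hη.le
        exact pow_le_pow_left₀ (scale_pos hL1 hη j').le h1 3
      exact mul_le_mul hsc hq (norm_nonneg _) (by positivity)
    have hLap' : bondNorm L t.k t.η (-((3 : ℕ) : ℝ)) (fun _ => (Set.univ : Set (LSite d)))
        (fun x μ => covLap t.η U₀ (fun z => A z μ) x) ≤ B₁ * s := by
      have e : (-((3 : ℕ) : ℝ)) = -(3 : ℝ) := by norm_num
      rw [e]; exact hLap
    have h := le_of_weight_mul_le (F := fun b : LSite d × Fin d => covLap t.η U₀ (fun z => A z b.2) b.1)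
      hL1 hη 3 hbdd hLap' hj (i := (x, κ)) (Or.inl (Set.mem_univ x))
    exact h.trans_lt (hlt 3 j)

end Pointwise

#print axioms thm2T_pointwise_of_socketsE

end Literature.MathematicalPhysics.QuantumFieldTheory.Balaban1983to89.B8Thm2TorusPointwise

end
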